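import Literature.Analysis.FluidPDE.SawtoothCascadeK2Classical
import HarnessLib

/-!
# The per-phase LIPSCHITZ cap of the linearised sawtooth cascade, CLASSICAL typing (`K2LipschitzGrowthClassical`)

One-definition sequel of `SawtoothCascadeK2Classical.lean` (cell `ad-ideate`; text = the K3loc lead's receptacle
`HOME/ad-sawtooth-lead/K2LipschitzGrowth_def.lean`, CENSUS-ApproxSol58-g3.md §2/§4 ask (b) «move
`K2LipschitzGrowthClassical` into Literature next to `K2PhaseGrowthClassical` (incl. `.mono`)», statement landed
verbatim): the hypothesis that the closure bookkeeping of `ApproxSol58` / `stub_responseStrainDefect` needs and that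
`K2″` (`K2PhaseGrowthClassical`, an `L² → L²` cap) does not supply.

Same quantifier block and solution class as `K2PhaseGrowthClassical P C` (one threshold `ν₀` for all `j₀ ≤ J`, comb
data `ShearCombDatum (P.N j₀) hz w₀`, classical solutions `(w, q)` of the Navier–Stokes equations linearised at the
cascade carrier on `[tInject j₀ hz, tStart (J+1)]` — Yoshida–Kaneda's passive-vector / linearised model with
`(α, β) = (1, 1)`), with the conclusion in the LIPSCHITZ size `sup_x ‖Dw(t,x)‖` (`Torus.fderiv`, operator norm)
instead of `‖w(t)‖_{L²}`: on the phase-`J` window, `‖Dw(t,x)‖ ≤ G^{J+1−j₀} · (D₁ + (N_{j₀}/δ_{j₀}) D₀)` where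
`D₀ ≥ sup‖w₀‖`, `D₁ ≥ sup‖Dw₀‖` measure the datum in the interface-adapted Lipschitz norm (the second term: the
response's gradient lives on the rounded-corner strips of width `δ/N` of the running profile, so a smooth low-mode
comb datum is amplified in Lipschitz norm by `~1/δ_{j₀}` in its first phase).

A predicate of the parameter point `P` and the per-phase factor `G` (a receptacle: nothing asserts it, no
implication with `K2PhaseGrowthClassical` is claimed).  The route-level conjecture over the box of `ApproxSol58`
(«some `G < (γ² − 3)²`») is a crux-sized statement and is NOT vendored here (it belongs to the route's items).
[cite: YoshidaKaneda2000, §II eq. (4)-(5) ((α,β)=(1,1): the linearised Navier–Stokes / passive-vector model)]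
[cite: Drazin2002, §8.3 Example 8.3 and Exercise 8.10 (σ⋆)] [problem: turb]
-/

open Set

namespace Literature.Analysis.FluidPDE.SawtoothCascade

open FunctionSpaces

/-- **Per-phase Lipschitz cap of the linearised cascade, CLASSICAL typing** (a receptacle: a predicate of the parameter
point `P` and the per-phase factor `G`; nothing asserts it).  Every comb-class injection `w₀` at phase `j₀` (H or V half)
generates, for every classical solution `(w, q)` of the Navier–Stokes equations linearised at the cascade carrier on
`[tInject j₀ hz, tStart (J+1)] × 𝕋²`, a response whose Lipschitz size on the phase-`J` window is at most
`G^{J+1−j₀}` times the interface-adapted Lipschitz size `D₁ + (N_{j₀}/δ_{j₀}) D₀` of the datum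
(`D₀ ≥ sup_x ‖w₀ x‖`, `D₁ ≥ sup_x ‖Dw₀(x)‖`), uniformly in `ν ∈ (0, ν₀]` with ONE `ν₀` for all `j₀ ≤ J`.
[cite: YoshidaKaneda2000, §II eq. (4)-(5) ((α,β)=(1,1): the linearised Navier–Stokes / passive-vector model)] -/
def K2LipschitzGrowthClassical (P : CascadeParams) (G : ℝ) : Prop :=
  ∃ ν₀ : ℝ, 0 < ν₀ ∧ ∀ ν ∈ Ioc 0 ν₀, ∀ (j₀ J : ℕ), j₀ ≤ J → ∀ (hz : Bool)
    (w₀ : UnitAddTorus (Fin 2) → EuclideanSpace ℝ (Fin 2))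
    (w : ℝ → UnitAddTorus (Fin 2) → EuclideanSpace ℝ (Fin 2)) (q : ℝ → UnitAddTorus (Fin 2) → ℝ),
    ShearCombDatum (P.N j₀) hz w₀ →
    Torus.IsSmoothSpaceTimeOn (Icc (CascadeParams.tInject j₀ hz) (CascadeParams.tStart (J + 1))) w →
    Torus.IsSmoothSpaceTimeOn (Icc (CascadeParams.tInject j₀ hz) (CascadeParams.tStart (J + 1))) q →
    (∀ t ∈ Icc (CascadeParams.tInject j₀ hz) (CascadeParams.tStart (J + 1)), Torus.IsDivFree (w t)) →
    (∀ t ∈ Icc (CascadeParams.tInject j₀ hz) (CascadeParams.tStart (J + 1)), ∀ x,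
      Torus.timeDerivWithin (Icc (CascadeParams.tInject j₀ hz) (CascadeParams.tStart (J + 1))) w t x +
        Torus.convect (P.field t) (w t) x + Torus.convect (w t) (P.field t) x =
        ν • Torus.laplacian (w t) x - Torus.gradient (q t) x) →
    w (CascadeParams.tInject j₀ hz) = w₀ →
    ∀ (D₀ D₁ : ℝ), (∀ x, ‖w₀ x‖ ≤ D₀) → (∀ x, ‖Torus.fderiv w₀ x‖ ≤ D₁) →
    ∀ t ∈ Icc (max (CascadeParams.tInject j₀ hz) (CascadeParams.tStart J)) (CascadeParams.tStart (J + 1)), ∀ x,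
      ‖Torus.fderiv (w t) x‖ ≤ G ^ (J + 1 - j₀) * (D₁ + (P.N j₀ : ℝ) / P.δ j₀ * D₀)

/-- The Lipschitz cap is monotone in the factor: `G ≤ G'` with `0 ≤ G` gives the cap with `G'`
(the datum size `D₁ + (N/δ)D₀` is non-negative whenever the hypotheses are satisfiable and `0 ≤ N_j/δ_j`).
[cite: YoshidaKaneda2000, §II eq. (4)-(5)] -/
theorem K2LipschitzGrowthClassical.mono {P : CascadeParams} {G G' : ℝ} (h : K2LipschitzGrowthClassical P G)
    (hG : 0 ≤ G) (hGG' : G ≤ G') (hNδ : ∀ j, 0 ≤ (P.N j : ℝ) / P.δ j) : K2LipschitzGrowthClassical P G' := by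
  obtain ⟨ν₀, hν₀, H⟩ := h
  refine ⟨ν₀, hν₀, fun ν hν j₀ J hj hz w₀ w q hd hw hq hdiv heq h0 D₀ D₁ hD₀ hD₁ t ht x => ?_⟩
  have h1 := H ν hν j₀ J hj hz w₀ w q hd hw hq hdiv heq h0 D₀ D₁ hD₀ hD₁ t ht x
  have hD₀' : 0 ≤ D₀ := (norm_nonneg _).trans (hD₀ x)
  have hD₁' : 0 ≤ D₁ := (norm_nonneg _).trans (hD₁ x)
  have hS : 0 ≤ D₁ + (P.N j₀ : ℝ) / P.δ j₀ * D₀ := add_nonneg hD₁' (mul_nonneg (hNδ j₀) hD₀')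
  exact h1.trans (mul_le_mul_of_nonneg_right (pow_le_pow_left₀ hG hGG' _) hS)

/-- With positive rounding data `0 < δ₀`, `0 < d` (every registered parameter point has `δ₀ = 1/4`, `d = 2`) the
side condition of `K2LipschitzGrowthClassical.mono` holds (`CascadeParams.δ_pos`), so the cap is monotone in `G`
outright. [cite: YoshidaKaneda2000, §II eq. (4)-(5)] -/
theorem K2LipschitzGrowthClassical.mono' {P : CascadeParams} {G G' : ℝ}
    (h : K2LipschitzGrowthClassical P G) (hG : 0 ≤ G) (hGG' : G ≤ G') (h₀ : 0 < P.δ₀) (hd : 0 < P.d) :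
    K2LipschitzGrowthClassical P G' :=
  h.mono hG hGG' fun j => div_nonneg (Nat.cast_nonneg _) (CascadeParams.δ_pos P h₀ hd j).le

end Literature.Analysis.FluidPDE.SawtoothCascade
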